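import Summits.FinalStateConjecture.FinalStateConjecture.Theorems.ZeroEnergyKerrOrBombStationaryLimitReductionRecutCoveringJunctionCore
import Literature.Geometry.Lorentzian.MinkowskiGlobalHyperbolicity
import HarnessLib

/-!
# Route ZeroEnergyKerrOrBomb · crux `FinalStateFromKerrOrBomb` (stmt-FinalStateConjecture-17839), line
# `SketchIdeator1` — stub `stub_recutJunctionCoreOriented`: the ENTRY-POINT brick of the past-boundary property —
# a causal curve running in a late chart and crossing a chart-time level meets the slab of that level

Helper file (`--supports stmt-FinalStateConjecture-17839`; registered helper `junction_slabCrossing_flat`) of the lead's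
wave-3 stub worker (2026-08-17), companion of `…RecutJunctionPastBoundary.lean` (p141631), where the oriented junction
core is reduced to the past-boundary property (PB) of the recut certified late region. The proof of (PB) is an
entry-point argument: a future causal curve from a point of chart time `≤ τ₁` to a point of chart time `> τ₁` must
cross the level `τ₁`. This file proves the chart-local form of that step, which needs NO pinching and NO orientation
clause — only the continuity of the chart time and the open-embedding property of late charts:

* §1 `exists_lift_of_isLateChart` (private copy of the wave-2 lemma, `…JunctionTimeFunction.lean`, unbuilt today):
  a continuous curve in the late image of a late chart lifts continuously and uniquely among late points.
* §2 `slabCrossing_of_isLateChart` (general background with continuous time function): if a future causal curve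
  `γ` on `[a, b]` runs in `ψ(S)`, `S` late, and the chart times of its endpoints straddle `τ₁`, then some
  `γ s⋆`, `s⋆ ∈ [a, b]`, is the chart point of a point of `S` of chart time EXACTLY `τ₁`, and `γ a ≤ γ s⋆`
  (intermediate value theorem along the lift; restriction of a causal curve).
* §3 `junction_slabCrossing_flat`: the flat specialisation — `γ a ∈ J⁻(Ψ₀({x⁰ = τ₁} ∩ U₀))`; and the boosted
  Kerr–Schild specialisation `slabCrossing_boostedKerr` (rest-frame time `t* = (Λ⁻¹(· − c₀))⁰`).

Elementary; no named fact, nothing restated. References: O'Neill 1983, Ch. 14, pp. 402–403; Dafermos–Luk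
arXiv:1710.01722, Conjecture 1 (b)–(c).
-/

set_option linter.dupNamespace false

noncomputable section

open scoped Manifold ContDiff Topology ENNReal
open Set Filter Function Topology Literature.Geometry.Lorentzian

namespace Summit.FinalStateConjecture.FinalStateConjecture.Theorems.SymplecticDualOfTheBomb

open Summit.FinalStateConjecture.FinalStateConjecture.Theorems.OneLockedExplosion

/-! ## §1 Lifts through late charts -/

section Lift

variable {𝓢 : Spacetime.{0} 4} {B : ModelBackground}

/-- Private copy of `exists_lift_of_isLateChart` (`…JunctionTimeFunction.lean`, p138446, unbuilt today): a curve
continuous on a nonempty `s₀` and running in `ψ(S)`, `S` late, lifts to a curve in `S` continuous on `s₀` with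
`ψ ∘ β = γ`; the lift is unique among late points. [folklore] -/
private theorem exists_lift_of_isLateChart_w3c {O : Set 𝓢.carrier} {τ₀ : ℝ} {ψ : B.domain → 𝓢.carrier}
    (hψ : 𝓢.IsLateChart B O τ₀ ψ) {S : Set B.domain} (hS : S ⊆ B.lateRegion τ₀) {γ : ℝ → 𝓢.carrier}
    {s₀ : Set ℝ} (hne : s₀.Nonempty) (hγc : ContinuousOn γ s₀) (hγS : MapsTo γ s₀ (ψ '' S)) :
    ∃ β : ℝ → B.domain, ContinuousOn β s₀ ∧ EqOn (ψ ∘ β) γ s₀ ∧ MapsTo β s₀ S ∧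
      ∀ s ∈ s₀, ∀ x ∈ B.lateRegion τ₀, ψ x = γ s → x = β s := by
  obtain ⟨t₀, ht₀⟩ := hne
  obtain ⟨z₀, hz₀, -⟩ := hγS ht₀
  haveI : Nonempty (B.lateRegion τ₀) := ⟨⟨z₀, hS hz₀⟩⟩
  set e : B.lateRegion τ₀ → 𝓢.carrier := (B.lateRegion τ₀).restrict ψ with he_def
  have he : IsOpenEmbedding e := hψ.isOpenEmbedding
  set φ := he.toOpenPartialHomeomorph e with hφ
  have hr : MapsTo γ s₀ (range e) := fun s hs ↦ by
    obtain ⟨z, hz, hzs⟩ := hγS hs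
    exact ⟨⟨z, hS hz⟩, hzs⟩
  refine ⟨fun s ↦ ((φ.symm (γ s) : B.lateRegion τ₀) : B.domain), ?_, fun s hs ↦ ?_, fun s hs ↦ ?_,
    fun s hs x hx hxs ↦ ?_⟩
  · have hsymm : ContinuousOn φ.symm (range e) := by
      have h := φ.continuousOn_symm
      rwa [hφ, he.toOpenPartialHomeomorph_target] at h
    exact continuous_subtype_val.comp_continuousOn (hsymm.comp hγc hr)
  · show e (φ.symm (γ s)) = γ s
    rw [hφ]; exact he.toOpenPartialHomeomorph_right_inv e (hr hs)
  · obtain ⟨z, hz, hzs⟩ := hγS hs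
    show ((φ.symm (γ s) : B.lateRegion τ₀) : B.domain) ∈ S
    rw [← hzs, show ψ z = e ⟨z, hS hz⟩ from rfl, hφ, he.toOpenPartialHomeomorph_left_inv]
    exact hz
  · show x = ((φ.symm (γ s) : B.lateRegion τ₀) : B.domain)
    rw [← hxs, show ψ x = e ⟨x, hx⟩ from rfl, hφ, he.toOpenPartialHomeomorph_left_inv]

end Lift

/-! ## §2 Crossing a chart-time level inside a late chart -/

section Crossing

variable {𝓢 : Spacetime.{0} 4} {B : ModelBackground}

/-- **A causal curve running in a late chart whose endpoint chart times straddle `τ₁` meets the level `τ₁`.** Let `ψ`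
be a late chart on a background `B` with CONTINUOUS time function, `S` a subset of its late region, `γ` a future causal
curve on `[a, b]` running in `ψ(S)` with `ψ x = γ a`, `ψ y = γ b`, `x, y` late and `B.time x ≤ τ₁ ≤ B.time y`. Then
there are `s⋆ ∈ [a, b]` and `z ∈ S` with `B.time z = τ₁`, `ψ z = γ s⋆`, and `γ a ∈ J⁻(γ s⋆)` (intermediate value
theorem along the continuous lift; a restricted causal curve is causal). No pinching, no orientation clause.
O'Neill 1983, Ch. 14, pp. 402–403. [folklore] -/
theorem slabCrossing_of_isLateChart (htime : Continuous B.time) {O : Set 𝓢.carrier} {τ₀ : ℝ}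
    {ψ : B.domain → 𝓢.carrier} (hψ : 𝓢.IsLateChart B O τ₀ ψ) {S : Set B.domain} (hS : S ⊆ B.lateRegion τ₀)
    {γ : ℝ → 𝓢.carrier} {a b : ℝ} (hab : a ≤ b) (hγ : 𝓢.metric.IsFutureCausalCurveOn 𝓢.timeOrientation γ (Icc a b))
    (hγS : MapsTo γ (Icc a b) (ψ '' S)) {x y : B.domain} (hx : x ∈ B.lateRegion τ₀) (hy : y ∈ B.lateRegion τ₀)
    (hxa : ψ x = γ a) (hyb : ψ y = γ b) {τ₁ : ℝ} (hx₁ : B.time x.1 ≤ τ₁) (hy₁ : τ₁ ≤ B.time y.1) :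
    ∃ s ∈ Icc a b, ∃ z ∈ S, B.time z.1 = τ₁ ∧ ψ z = γ s ∧
      γ a ∈ 𝓢.metric.causalPast 𝓢.timeOrientation {γ s} := by
  obtain ⟨β, hβc, hβγ, hβS, huniq⟩ := exists_lift_of_isLateChart_w3c hψ hS ⟨a, left_mem_Icc.2 hab⟩
    (fun r hr ↦ (hγ.continuousAt hr).continuousWithinAt) hγS
  have hxβ : x = β a := huniq a (left_mem_Icc.2 hab) x hx hxa
  have hyβ : y = β b := huniq b (right_mem_Icc.2 hab) y hy hyb
  -- intermediate value theorem for `s ↦ B.time (β s)`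
  have hfc : ContinuousOn (fun s ↦ B.time (β s).1) (Icc a b) :=
    (htime.comp continuous_subtype_val).comp_continuousOn hβc
  have hτ₁ : τ₁ ∈ Icc (B.time (β a).1) (B.time (β b).1) := ⟨by rwa [← hxβ], by rwa [← hyβ]⟩
  obtain ⟨s, hs, hsτ⟩ := intermediate_value_Icc hab hfc hτ₁
  refine ⟨s, hs, β s, hβS hs, hsτ, hβγ hs, ?_⟩
  -- `γ a ≤ γ s` along the restriction of `γ` to `[a, s]`
  rcases hs.1.eq_or_lt with rfl | has
  · exact LorentzianMetric.subset_causalPast _ _ _ (mem_singleton _)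
  · exact LorentzianMetric.mem_causalPast_of_mem_causalFuture
      (Or.inr ⟨γ a, mem_singleton _, γ, a, s, has, hγ.mono (Icc_subset_Icc_right hs.2), rfl, rfl⟩)

end Crossing

/-! ## §3 The flat and the boosted Kerr–Schild specialisations -/

/-- **Registered helper `junction_slabCrossing_flat` (stub `stub_recutJunctionCoreOriented`, entry-point brick for (PB),
flat chart).** For a late flat chart `Ψ₀` on `U₀`, a subset `S` of its late region, and a future causal curve `γ` on
`[a, b]` running in `Ψ₀(S)` from `Ψ₀ x` to `Ψ₀ y` (`x, y` late) with `x⁰ ≤ τ₁ ≤ y⁰`: `γ a` lies in the causal past of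
the flat slab `Ψ₀({x⁰ = τ₁} ∩ U₀)` — indeed of a point `Ψ₀ z`, `z ∈ S`, `z⁰ = τ₁`, on the curve. [folklore] -/
theorem junction_slabCrossing_flat : ∀ (𝓢 : Spacetime.{0} 4) (U : TopologicalSpace.Opens E4) (O : Set 𝓢.carrier) (τ₀ : ℝ) (ψ : (Minkowski.backgroundOn U).domain → 𝓢.carrier), 𝓢.IsLateChart (Minkowski.backgroundOn U) O τ₀ ψ → ∀ (S : Set (Minkowski.backgroundOn U).domain), S ⊆ (Minkowski.backgroundOn U).lateRegion τ₀ → ∀ (γ : ℝ → 𝓢.carrier) (a b : ℝ), a ≤ b → 𝓢.metric.IsFutureCausalCurveOn 𝓢.timeOrientation γ (Set.Icc a b) → Set.MapsTo γ (Set.Icc a b) (ψ '' S) → ∀ (x y : (Minkowski.backgroundOn U).domain), x ∈ (Minkowski.backgroundOn U).lateRegion τ₀ → y ∈ (Minkowski.backgroundOn U).lateRegion τ₀ → ψ x = γ a → ψ y = γ b → ∀ (τ₁ : ℝ), (x : E4) 0 ≤ τ₁ → τ₁ ≤ (y : E4) 0 → ∃ s ∈ Set.Icc a b, ∃ z ∈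 S, (z : E4) 0 = τ₁ ∧ ψ z = γ s ∧ γ a ∈ 𝓢.metric.causalPast 𝓢.timeOrientation (ψ '' (Minkowski.backgroundOn U).timeSlab τ₁) := by
  intro 𝓢 U O τ₀ ψ hψ S hS γ a b hab hγ hγS x y hx hy hxa hyb τ₁ hx₁ hy₁
  obtain ⟨s, hs, z, hz, hzτ, hzs, hJ⟩ := slabCrossing_of_isLateChart (B := Minkowski.backgroundOn U)
    (EuclideanSpace.proj (𝕜 := ℝ) (0 : Fin 4)).continuous hψ hS hab hγ hγS hx hy hxa hyb hx₁ hy₁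
  refine ⟨s, hs, z, hz, hzτ, hzs, LorentzianMetric.causalFuture_mono (singleton_subset_iff.2 ?_) hJ⟩
  rw [← hzs]
  exact mem_image_of_mem _ hzτ

/-- **The boosted Kerr–Schild specialisation** (recut hole charts): for a late chart `ψ` on
`boostedKerrBackground Λ c₀ M a` the same holds with the rest-frame time `t* = (Λ⁻¹(· − c₀))⁰`; the crossing point
`z ∈ S` has `t*(z) = τ₁`, so it lies in the recut slab `{t* = τ₁, r ≤ R'}` as soon as `S ⊆ {r ≤ R'}`. [folklore] -/
theorem slabCrossing_boostedKerr {𝓢 : Spacetime.{0} 4} {Λ : lorentzGroup} {c₀ : E4} {M a : ℝ} {O : Set 𝓢.carrier}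
    {τ₀ : ℝ} {ψ : (boostedKerrBackground Λ c₀ M a).domain → 𝓢.carrier}
    (hψ : 𝓢.IsLateChart (boostedKerrBackground Λ c₀ M a) O τ₀ ψ)
    {S : Set (boostedKerrBackground Λ c₀ M a).domain} (hS : S ⊆ (boostedKerrBackground Λ c₀ M a).lateRegion τ₀)
    {γ : ℝ → 𝓢.carrier} {a' b' : ℝ} (hab : a' ≤ b')
    (hγ : 𝓢.metric.IsFutureCausalCurveOn 𝓢.timeOrientation γ (Icc a' b')) (hγS : MapsTo γ (Icc a' b') (ψ '' S))
    {x y : (boostedKerrBackground Λ c₀ M a).domain} (hx : x ∈ (boostedKerrBackground Λ c₀ M a).lateRegion τ₀)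
    (hy : y ∈ (boostedKerrBackground Λ c₀ M a).lateRegion τ₀) (hxa : ψ x = γ a') (hyb : ψ y = γ b') {τ₁ R' : ℝ}
    (hx₁ : poincareInv Λ c₀ x.1 0 ≤ τ₁) (hy₁ : τ₁ ≤ poincareInv Λ c₀ y.1 0)
    (hSR : ∀ z ∈ S, Kerr.radius a (poincareInv Λ c₀ z.1) ≤ R') :
    ∃ s ∈ Icc a' b', ∃ z ∈ S, poincareInv Λ c₀ z.1 0 = τ₁ ∧ ψ z = γ s ∧
      γ a' ∈ 𝓢.metric.causalPast 𝓢.timeOrientation (ψ '' (boostedKerrBackground Λ c₀ M a).truncTimeSlab R' τ₁) := by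
  obtain ⟨s, hs, z, hz, hzτ, hzs, hJ⟩ := slabCrossing_of_isLateChart (B := boostedKerrBackground Λ c₀ M a)
    ((EuclideanSpace.proj (𝕜 := ℝ) (0 : Fin 4)).continuous.comp (continuous_poincareInv Λ c₀)) hψ hS hab hγ hγS
    hx hy hxa hyb hx₁ hy₁
  refine ⟨s, hs, z, hz, hzτ, hzs, LorentzianMetric.causalFuture_mono (singleton_subset_iff.2 ?_) hJ⟩
  rw [← hzs]
  exact mem_image_of_mem _ ⟨hzτ, hSR z hz⟩

end Summit.FinalStateConjecture.FinalStateConjecture.Theorems.SymplecticDualOfTheBomb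

end
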